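import Literature.MeasureTheory.Group.FundamentalDomainProductSlices
import Mathlib.MeasureTheory.Integral.Bochner.Set
import Mathlib.MeasureTheory.Group.Integral
import Mathlib.MeasureTheory.Constructions.BorelSpace.Basic
import Mathlib.Topology.Algebra.Group.Pointwise
import HarnessLib

/-!
# Lattice sums versus integrals, ADDITIVE edition: the cell decomposition over a fundamental domain
# of a lattice `Λ ≤ A`, the oscillation bound `‖Σ_{λ} G(λ + s) − μ(P)⁻¹ ∫ G dμ‖ ≤ ω · μ(B) / μ(P)`,
# and its packaging for compactly supported `G`, uniformly in the shift `s`

Topic `MeasureTheory/Group`; namespace `Literature.MeasureTheory.Group`. KERNEL only (imports: Mathlib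
and ★ `FundamentalDomainProductSlices` for the `AddSubgroup`-action plumbing): proved theorems, no
definition, no named fact, no instance, no `sorry`.

This is the additive (`+ᵥ`, `IsAddFundamentalDomain`, `AddSubgroup`) edition of the tree's
★ `FundamentalDomainLatticeSum` ([Weil1965, Chap. I n° 12, proof of Lemme 5]: each lattice point
is charged with the oscillation of the function over its cell, and the charged cells are counted by
the measure they fill), which is stated for multiplicative actions only and carries no
`@[to_additive]` tags; §1–§6 port its statements and proofs token for token, §7 adds the package
consumed by the parabolic terms of the rank-one trace formula (Rogawski (1990), §7.2, p. 95
«absolutely integrable for every `T`»; Arthur's §8 way, one power of the mesh, no Poisson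
summation):

* §1 `integral_eq_sum_setIntegral_vadd` — `∫ φ dν = Σ_{γ ∈ R} ∫_𝓕 φ(γ +ᵥ u) dν(u)` when `φ`
  is carried by the cells `γ +ᵥ 𝓕`, `γ ∈ R` (Mathlib `IsAddFundamentalDomain.integral_eq_tsum''`);
* §2 `sum_sub_smul_integral_eq_of_vadd` — the CELL DECOMPOSITION
  `Σ_{γ ∈ R} a(γ) − ν(𝓕)⁻¹ ∫ φ dν = ν(𝓕)⁻¹ Σ_{γ ∈ R} ∫_𝓕 (a(γ) − φ(γ +ᵥ u)) dν(u)`;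
* §3 `norm_sum_sub_smul_integral_le_of_vadd` — the OSCILLATION BOUND `≤ |R| · ε`;
* §4 `card_mul_measure_le_of_vadd_subset` — the CELL COUNT `|R| · ν(𝓕) ≤ ν(B)`;
* §5 `norm_[t]sum_sub_smul_integral_le_of_vadd_subset` — the package `≤ ε · ν(B) / ν(𝓕)`;
* §6 translation by an additive subgroup `Λ ≤ A` of a commutative group (the action plumbing is
  ★ `measurableConstVAdd_addSubgroup` / `vaddInvariantMeasure_addSubgroup`): `…_of_add_subset`,
  `sum_sub_smul_integral_eq_of_addSubgroup`;
* §7 **(F4) LATTICE SUM VS NORMALISED INTEGRAL, compact support, uniform in the shift**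
  `norm_tsum_add_sub_smul_integral_le_of_isCompact`: for a commutative locally compact group `A`
  with an invariant measure `μ` finite on compacts, a countable subgroup `Λ` meeting every compact
  set in finitely many points, a fundamental domain `P` of non-zero measure and compact closure,
  `G` integrable and supported in a compact `C`, with `‖G(a) − G(a + v)‖ ≤ ω` for `v ∈ P`:
  for every shift `s`, the lattice points `λ` with `G(λ + s) ≠ 0` are finite in number and
  `‖Σ_{λ ∈ Λ} G(λ + s) − μ(P)⁻¹ ∫ G dμ‖ ≤ ω · μ((C − ({0} ∪ P̄)) + P̄) / μ(P)` — a bound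
  independent of `s`.

Cell `hodgecm-mathlib`, ENGINE T1 (crux H413 = `stmt-HodgeConjecture-24833`), T1-qs road LAW 5
(L5-iii-b2) brick (F4) of the (b2-β)/(b2-α′) cut. HC_CM is proved only modulo the printed citations
until rung 0 closes; this file is unconditional and touches no binder.

## References

* [Weil1965] A. Weil, *Sur la formule de Siegel dans la théorie des groupes classiques*, Acta Math.
  113 (1965), Chap. I n° 12, proof of Lemme 5, pp. 21–22.
* [Rogawski1990] J. Rogawski, *Automorphic representations of unitary groups in three variables*,
  Ann. of Math. Studies 123 (1990), §7.2 (p. 95).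
-/

set_option autoImplicit false

noncomputable section

open MeasureTheory Set Filter
open scoped ENNReal NNReal Pointwise BigOperators

namespace Literature.MeasureTheory.Group

variable {Γ α : Type*} [AddGroup Γ] [AddAction Γ α] [MeasurableSpace α] [MeasurableConstVAdd Γ α]
  [Countable Γ] {ν : Measure α} [VAddInvariantMeasure Γ α ν]
  {V : Type*} [NormedAddCommGroup V] [NormedSpace ℝ V] [CompleteSpace V]
  {𝓕 : Set α} {φ : α → V}

/-! ## §1 The cell decomposition of the integral -/

omit [CompleteSpace V] in
/-- The cells carrying `φ`: if `φ (γ +ᵥ u) = 0` for `u ∈ 𝓕`, `γ ∉ R`, then the unfolded integral is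
a finite sum: **`∫_α φ dν = Σ_{γ ∈ R} ∫_𝓕 φ(γ +ᵥ u) dν(u)`**
(Mathlib `IsAddFundamentalDomain.integral_eq_tsum''`).
[cite: Weil1965, Chap. I n° 12, proof of Lemme 5 (pp. 21–22)] -/
theorem integral_eq_sum_setIntegral_vadd (h𝓕 : IsAddFundamentalDomain Γ 𝓕 ν) (hφ : Integrable φ ν)
    (R : Finset Γ) (hR : ∀ γ ∉ R, ∀ u ∈ 𝓕, φ (γ +ᵥ u) = 0) :
    ∫ x, φ x ∂ν = ∑ γ ∈ R, ∫ u in 𝓕, φ (γ +ᵥ u) ∂ν := by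
  rw [h𝓕.integral_eq_tsum'' φ hφ]
  exact tsum_eq_sum fun γ hγ => setIntegral_eq_zero_of_forall_eq_zero (hR γ hγ)

omit [MeasurableSpace α] [MeasurableConstVAdd Γ α] [Countable Γ] [NormedSpace ℝ V] [CompleteSpace V] in
/-- A sufficient condition for the finiteness hypothesis: `φ` is supported in `S` and the cells
`γ +ᵥ 𝓕`, `γ ∉ R`, do not meet `S`. [cite: Weil1965, Chap. I n° 12, proof of Lemme 5 (pp. 21–22)] -/
theorem forall_vadd_eq_zero_of_disjoint {S : Set α} (hS : Function.support φ ⊆ S) (R : Finset Γ)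
    (hR : ∀ γ ∉ R, Disjoint (γ +ᵥ 𝓕) S) : ∀ γ ∉ R, ∀ u ∈ 𝓕, φ (γ +ᵥ u) = 0 := by
  intro γ hγ u hu
  by_contra h
  exact Set.disjoint_left.1 (hR γ hγ) (Set.vadd_mem_vadd_set hu) (hS h)

omit [Countable Γ] [NormedSpace ℝ V] [CompleteSpace V] in
/-- Each unfolded term is integrable: `u ↦ φ(γ +ᵥ u)` is integrable on `𝓕` (the action preserves
`ν`). [cite: Weil1965, Chap. I n° 12, proof of Lemme 5 (pp. 21–22)] -/
theorem integrableOn_comp_vadd (hφ : Integrable φ ν) (γ : Γ) (s : Set α) :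
    IntegrableOn (fun u => φ (γ +ᵥ u)) s ν := by
  have h : Integrable (φ ∘ fun u : α => γ +ᵥ u) ν :=
    ((measurePreserving_vadd γ ν).integrable_comp_emb (measurableEmbedding_const_vadd γ)).2 hφ
  exact h.integrableOn

/-! ## §2 The identity `Σ a(γ) − ν(𝓕)⁻¹ ∫ φ = ν(𝓕)⁻¹ Σ ∫_𝓕 (a(γ) − φ(γ +ᵥ u))` -/

omit [Countable Γ] in
/-- One cell: `∫_𝓕 (a − φ(γ +ᵥ u)) dν(u) = ν(𝓕) • a − ∫_𝓕 φ(γ +ᵥ u) dν(u)`.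
[cite: Weil1965, Chap. I n° 12, proof of Lemme 5 (pp. 21–22)] -/
theorem setIntegral_const_sub_comp_vadd (hφ : Integrable φ ν) (htop : ν 𝓕 ≠ ∞) (a : V) (γ : Γ) :
    ∫ u in 𝓕, (a - φ (γ +ᵥ u)) ∂ν = (ν 𝓕).toReal • a - ∫ u in 𝓕, φ (γ +ᵥ u) ∂ν := by
  have hc : IntegrableOn (fun _ : α => a) 𝓕 ν := integrableOn_const htop
  rw [integral_sub hc (integrableOn_comp_vadd hφ γ 𝓕), setIntegral_const]
  rfl

/-- **THE CELL DECOMPOSITION (additive).** For a fundamental domain `𝓕` of finite non-zero measure,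
an integrable `φ` carried by the cells `γ +ᵥ 𝓕`, `γ ∈ R`, and any sample values `a : Γ → V`:
`Σ_{γ ∈ R} a(γ) − ν(𝓕)⁻¹ ∫ φ dν = ν(𝓕)⁻¹ Σ_{γ ∈ R} ∫_𝓕 (a(γ) − φ(γ +ᵥ u)) dν(u)`.
[cite: Weil1965, Chap. I n° 12, proof of Lemme 5 (pp. 21–22)] -/
theorem sum_sub_smul_integral_eq_of_vadd (h𝓕 : IsAddFundamentalDomain Γ 𝓕 ν) (hφ : Integrable φ ν)
    (h0 : ν 𝓕 ≠ 0) (htop : ν 𝓕 ≠ ∞) (R : Finset Γ) (hR : ∀ γ ∉ R, ∀ u ∈ 𝓕, φ (γ +ᵥ u) = 0)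
    (a : Γ → V) :
    ∑ γ ∈ R, a γ - (ν 𝓕).toReal⁻¹ • ∫ x, φ x ∂ν =
      (ν 𝓕).toReal⁻¹ • ∑ γ ∈ R, ∫ u in 𝓕, (a γ - φ (γ +ᵥ u)) ∂ν := by
  have hr : (ν 𝓕).toReal ≠ 0 := ENNReal.toReal_ne_zero.2 ⟨h0, htop⟩
  simp_rw [setIntegral_const_sub_comp_vadd hφ htop]
  rw [Finset.sum_sub_distrib, ← Finset.smul_sum, ← integral_eq_sum_setIntegral_vadd h𝓕 hφ R hR,
    smul_sub, smul_smul, inv_mul_cancel₀ hr, one_smul]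

/-- `tsum` form: if moreover `a` vanishes off `R`, then
`Σ'_{γ ∈ Γ} a(γ) − ν(𝓕)⁻¹ ∫ φ dν = ν(𝓕)⁻¹ Σ_{γ ∈ R} ∫_𝓕 (a(γ) − φ(γ +ᵥ u)) dν(u)`.
[cite: Weil1965, Chap. I n° 12, proof of Lemme 5 (pp. 21–22)] -/
theorem tsum_sub_smul_integral_eq_of_vadd (h𝓕 : IsAddFundamentalDomain Γ 𝓕 ν) (hφ : Integrable φ ν)
    (h0 : ν 𝓕 ≠ 0) (htop : ν 𝓕 ≠ ∞) (R : Finset Γ) (hR : ∀ γ ∉ R, ∀ u ∈ 𝓕, φ (γ +ᵥ u) = 0)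
    {a : Γ → V} (ha : ∀ γ ∉ R, a γ = 0) :
    ∑' γ, a γ - (ν 𝓕).toReal⁻¹ • ∫ x, φ x ∂ν =
      (ν 𝓕).toReal⁻¹ • ∑ γ ∈ R, ∫ u in 𝓕, (a γ - φ (γ +ᵥ u)) ∂ν := by
  rw [tsum_eq_sum ha]
  exact sum_sub_smul_integral_eq_of_vadd h𝓕 hφ h0 htop R hR a

/-! ## §3 The oscillation bound -/

omit [MeasurableConstVAdd Γ α] [Countable Γ] [VAddInvariantMeasure Γ α ν] [CompleteSpace V] in
/-- One cell: if `‖a − φ(γ +ᵥ u)‖ ≤ ε` on `𝓕` then `‖∫_𝓕 (a − φ(γ +ᵥ u)) dν(u)‖ ≤ ε · ν(𝓕)`.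
[cite: Weil1965, Chap. I n° 12, proof of Lemme 5 (pp. 21–22)] -/
theorem norm_setIntegral_const_sub_comp_vadd_le (htop : ν 𝓕 ≠ ∞) {a : V} {γ : Γ} {ε : ℝ}
    (hosc : ∀ u ∈ 𝓕, ‖a - φ (γ +ᵥ u)‖ ≤ ε) :
    ‖∫ u in 𝓕, (a - φ (γ +ᵥ u)) ∂ν‖ ≤ ε * (ν 𝓕).toReal :=
  norm_setIntegral_le_of_norm_le_const htop.lt_top hosc

/-- **THE OSCILLATION BOUND (additive).** If `‖a(γ) − φ(γ +ᵥ u)‖ ≤ ε` for all `γ ∈ R` and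
`u ∈ 𝓕`, then `‖Σ_{γ ∈ R} a(γ) − ν(𝓕)⁻¹ ∫ φ dν‖ ≤ |R| · ε`.
[cite: Weil1965, Chap. I n° 12, proof of Lemme 5 (pp. 21–22)] -/
theorem norm_sum_sub_smul_integral_le_of_vadd (h𝓕 : IsAddFundamentalDomain Γ 𝓕 ν)
    (hφ : Integrable φ ν) (h0 : ν 𝓕 ≠ 0) (htop : ν 𝓕 ≠ ∞) (R : Finset Γ)
    (hR : ∀ γ ∉ R, ∀ u ∈ 𝓕, φ (γ +ᵥ u) = 0) (a : Γ → V) {ε : ℝ}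
    (hosc : ∀ γ ∈ R, ∀ u ∈ 𝓕, ‖a γ - φ (γ +ᵥ u)‖ ≤ ε) :
    ‖∑ γ ∈ R, a γ - (ν 𝓕).toReal⁻¹ • ∫ x, φ x ∂ν‖ ≤ R.card * ε := by
  have hpos : 0 < (ν 𝓕).toReal := ENNReal.toReal_pos h0 htop
  rw [sum_sub_smul_integral_eq_of_vadd h𝓕 hφ h0 htop R hR a, norm_smul, norm_inv,
    Real.norm_eq_abs, abs_of_pos hpos]
  calc (ν 𝓕).toReal⁻¹ * ‖∑ γ ∈ R, ∫ u in 𝓕, (a γ - φ (γ +ᵥ u)) ∂ν‖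
      ≤ (ν 𝓕).toReal⁻¹ * ∑ γ ∈ R, ‖∫ u in 𝓕, (a γ - φ (γ +ᵥ u)) ∂ν‖ :=
        mul_le_mul_of_nonneg_left (norm_sum_le _ _) (inv_nonneg.2 hpos.le)
    _ ≤ (ν 𝓕).toReal⁻¹ * ∑ γ ∈ R, ε * (ν 𝓕).toReal :=
        mul_le_mul_of_nonneg_left (Finset.sum_le_sum fun γ hγ =>
          norm_setIntegral_const_sub_comp_vadd_le htop (hosc γ hγ)) (inv_nonneg.2 hpos.le)
    _ = R.card * ε := by
        rw [Finset.sum_const, nsmul_eq_mul]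
        field_simp

/-! ## §4 Counting the cells by the measure they fill -/

omit [Countable Γ] in
/-- **CELL COUNT (additive).** The translates `γ +ᵥ 𝓕` of a fundamental domain are a.e. disjoint
and of equal measure, so `|R| · ν(𝓕) ≤ ν(B)` whenever `γ +ᵥ 𝓕 ⊆ B` for all `γ ∈ R`.
[cite: Weil1965, Chap. I n° 12, proof of Lemme 5 (pp. 21–22)] -/
theorem card_mul_measure_le_of_vadd_subset (h𝓕 : IsAddFundamentalDomain Γ 𝓕 ν) (R : Finset Γ)
    {B : Set α} (hB : ∀ γ ∈ R, γ +ᵥ 𝓕 ⊆ B) : (R.card : ℝ≥0∞) * ν 𝓕 ≤ ν B := by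
  have hdisj : Set.Pairwise (↑R : Set Γ) (fun γ₁ γ₂ : Γ => AEDisjoint ν (γ₁ +ᵥ 𝓕) (γ₂ +ᵥ 𝓕)) :=
    h𝓕.aedisjoint.set_pairwise _
  calc (R.card : ℝ≥0∞) * ν 𝓕 = ∑ γ ∈ R, ν (γ +ᵥ 𝓕) := by
        simp_rw [measure_vadd, Finset.sum_const, nsmul_eq_mul]
    _ = ν (⋃ γ ∈ R, γ +ᵥ 𝓕) :=
        (measure_biUnion_finset₀ hdisj fun γ _ => h𝓕.nullMeasurableSet_vadd γ).symm
    _ ≤ ν B := measure_mono (Set.iUnion₂_subset hB)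

omit [Countable Γ] in
/-- Real form of the cell count: `|R| ≤ ν(B) / ν(𝓕)` for `ν(𝓕) ≠ 0` and `ν(B) < ∞`.
[cite: Weil1965, Chap. I n° 12, proof of Lemme 5 (pp. 21–22)] -/
theorem card_le_measureReal_div_of_vadd_subset (h𝓕 : IsAddFundamentalDomain Γ 𝓕 ν) (h0 : ν 𝓕 ≠ 0)
    (htop : ν 𝓕 ≠ ∞) (R : Finset Γ) {B : Set α} (hB : ∀ γ ∈ R, γ +ᵥ 𝓕 ⊆ B) (hBtop : ν B ≠ ∞) :
    (R.card : ℝ) ≤ (ν B).toReal / (ν 𝓕).toReal := by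
  have hpos : 0 < (ν 𝓕).toReal := ENNReal.toReal_pos h0 htop
  rw [le_div_iff₀ hpos]
  have h := card_mul_measure_le_of_vadd_subset h𝓕 R hB
  have h' : ((R.card : ℝ≥0∞) * ν 𝓕).toReal ≤ (ν B).toReal := ENNReal.toReal_mono hBtop h
  rwa [ENNReal.toReal_mul, ENNReal.toReal_natCast] at h'

/-! ## §5 The packaged estimate -/

/-- **LATTICE SUM VERSUS INTEGRAL (additive).** Let `𝓕` be a fundamental domain of finite
non-zero measure for a measure-preserving additive action of a countable group `Γ`, `φ` integrable
and carried by the cells `γ +ᵥ 𝓕`, `γ ∈ R`, all contained in a set `B` of finite measure, and suppose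
`‖a(γ) − φ(γ +ᵥ u)‖ ≤ ε` (`γ ∈ R`, `u ∈ 𝓕`) with `ε ≥ 0`. Then
`‖Σ_{γ ∈ R} a(γ) − ν(𝓕)⁻¹ ∫ φ dν‖ ≤ ε · ν(B) / ν(𝓕)`.
[cite: Weil1965, Chap. I n° 12, proof of Lemme 5 (pp. 21–22)] -/
theorem norm_sum_sub_smul_integral_le_of_vadd_subset (h𝓕 : IsAddFundamentalDomain Γ 𝓕 ν)
    (hφ : Integrable φ ν) (h0 : ν 𝓕 ≠ 0) (htop : ν 𝓕 ≠ ∞) (R : Finset Γ)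
    (hR : ∀ γ ∉ R, ∀ u ∈ 𝓕, φ (γ +ᵥ u) = 0) (a : Γ → V) {ε : ℝ} (hε : 0 ≤ ε)
    (hosc : ∀ γ ∈ R, ∀ u ∈ 𝓕, ‖a γ - φ (γ +ᵥ u)‖ ≤ ε) {B : Set α} (hB : ∀ γ ∈ R, γ +ᵥ 𝓕 ⊆ B)
    (hBtop : ν B ≠ ∞) :
    ‖∑ γ ∈ R, a γ - (ν 𝓕).toReal⁻¹ • ∫ x, φ x ∂ν‖ ≤ ε * ((ν B).toReal / (ν 𝓕).toReal) :=
  calc ‖∑ γ ∈ R, a γ - (ν 𝓕).toReal⁻¹ • ∫ x, φ x ∂ν‖ ≤ R.card * ε :=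
        norm_sum_sub_smul_integral_le_of_vadd h𝓕 hφ h0 htop R hR a hosc
    _ = ε * R.card := mul_comm _ _
    _ ≤ ε * ((ν B).toReal / (ν 𝓕).toReal) :=
        mul_le_mul_of_nonneg_left (card_le_measureReal_div_of_vadd_subset h𝓕 h0 htop R hB hBtop)
          hε

/-- `tsum` form of the packaged estimate, for sample values `a` vanishing off `R`:
`‖Σ'_{γ ∈ Γ} a(γ) − ν(𝓕)⁻¹ ∫ φ dν‖ ≤ ε · ν(B) / ν(𝓕)`.
[cite: Weil1965, Chap. I n° 12, proof of Lemme 5 (pp. 21–22)] -/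
theorem norm_tsum_sub_smul_integral_le_of_vadd_subset (h𝓕 : IsAddFundamentalDomain Γ 𝓕 ν)
    (hφ : Integrable φ ν) (h0 : ν 𝓕 ≠ 0) (htop : ν 𝓕 ≠ ∞) (R : Finset Γ)
    (hR : ∀ γ ∉ R, ∀ u ∈ 𝓕, φ (γ +ᵥ u) = 0) {a : Γ → V} (ha : ∀ γ ∉ R, a γ = 0) {ε : ℝ}
    (hε : 0 ≤ ε) (hosc : ∀ γ ∈ R, ∀ u ∈ 𝓕, ‖a γ - φ (γ +ᵥ u)‖ ≤ ε) {B : Set α}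
    (hB : ∀ γ ∈ R, γ +ᵥ 𝓕 ⊆ B) (hBtop : ν B ≠ ∞) :
    ‖∑' γ, a γ - (ν 𝓕).toReal⁻¹ • ∫ x, φ x ∂ν‖ ≤ ε * ((ν B).toReal / (ν 𝓕).toReal) := by
  rw [tsum_eq_sum ha]
  exact norm_sum_sub_smul_integral_le_of_vadd_subset h𝓕 hφ h0 htop R hR a hε hosc hB hBtop

/-! ## §6 Additive groups: translation by an additive subgroup -/

section AddSubgroup

variable {A : Type*} [AddCommGroup A] [MeasurableSpace A] [MeasurableAdd A] {μ : Measure A}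
  [μ.IsAddLeftInvariant] (Λ : AddSubgroup A) [Countable Λ]

/-- **LATTICE SUM VERSUS INTEGRAL, additive group form.** Let `μ` be a left-invariant measure on an
additive group `A`, `Λ ≤ A` a countable subgroup with a fundamental domain `𝓕` of finite non-zero
measure, `φ : A → V` integrable with `φ(γ + u) = 0` for `γ ∉ R`, `u ∈ 𝓕`, and suppose
`‖φ(γ) − φ(γ + u)‖ ≤ ε` for `γ ∈ R`, `u ∈ 𝓕`, with the cells `γ + 𝓕`, `γ ∈ R`, inside a set `B` of
finite measure. Then `‖Σ_{γ ∈ R} φ(γ) − μ(𝓕)⁻¹ ∫_A φ dμ‖ ≤ ε · μ(B) / μ(𝓕)`.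
[cite: Weil1965, Chap. I n° 12, proof of Lemme 5 (pp. 21–22)] -/
theorem norm_sum_sub_smul_integral_le_of_add_subset {𝓕 : Set A} {φ : A → V}
    (h𝓕 : IsAddFundamentalDomain Λ 𝓕 μ) (hφ : Integrable φ μ) (h0 : μ 𝓕 ≠ 0) (htop : μ 𝓕 ≠ ∞)
    (R : Finset Λ) (hR : ∀ γ ∉ R, ∀ u ∈ 𝓕, φ ((γ : A) + u) = 0) {ε : ℝ} (hε : 0 ≤ ε)
    (hosc : ∀ γ ∈ R, ∀ u ∈ 𝓕, ‖φ γ - φ ((γ : A) + u)‖ ≤ ε) {B : Set A}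
    (hB : ∀ γ ∈ R, (γ : A) +ᵥ 𝓕 ⊆ B) (hBtop : μ B ≠ ∞) :
    ‖∑ γ ∈ R, φ γ - (μ 𝓕).toReal⁻¹ • ∫ x, φ x ∂μ‖ ≤ ε * ((μ B).toReal / (μ 𝓕).toReal) := by
  haveI := measurableConstVAdd_addSubgroup Λ
  haveI : VAddInvariantMeasure Λ A μ := vaddInvariantMeasure_addSubgroup Λ μ
  exact norm_sum_sub_smul_integral_le_of_vadd_subset h𝓕 hφ h0 htop R hR (fun γ => φ γ) hε hosc
    hB hBtop

/-- `tsum` form of the additive group estimate: if `φ(γ) = 0` for `γ ∈ Λ ∖ R` as well, then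
`‖Σ'_{γ ∈ Λ} φ(γ) − μ(𝓕)⁻¹ ∫_A φ dμ‖ ≤ ε · μ(B) / μ(𝓕)`.
[cite: Weil1965, Chap. I n° 12, proof of Lemme 5 (pp. 21–22)] -/
theorem norm_tsum_sub_smul_integral_le_of_add_subset {𝓕 : Set A} {φ : A → V}
    (h𝓕 : IsAddFundamentalDomain Λ 𝓕 μ) (hφ : Integrable φ μ) (h0 : μ 𝓕 ≠ 0) (htop : μ 𝓕 ≠ ∞)
    (R : Finset Λ) (hR : ∀ γ ∉ R, ∀ u ∈ 𝓕, φ ((γ : A) + u) = 0) (hR' : ∀ γ ∉ R, φ γ = 0)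
    {ε : ℝ} (hε : 0 ≤ ε) (hosc : ∀ γ ∈ R, ∀ u ∈ 𝓕, ‖φ γ - φ ((γ : A) + u)‖ ≤ ε) {B : Set A}
    (hB : ∀ γ ∈ R, (γ : A) +ᵥ 𝓕 ⊆ B) (hBtop : μ B ≠ ∞) :
    ‖∑' γ : Λ, φ γ - (μ 𝓕).toReal⁻¹ • ∫ x, φ x ∂μ‖ ≤ ε * ((μ B).toReal / (μ 𝓕).toReal) := by
  rw [tsum_eq_sum (s := R) (fun γ hγ => hR' γ hγ)]
  exact norm_sum_sub_smul_integral_le_of_add_subset Λ h𝓕 hφ h0 htop R hR hε hosc hB hBtop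

/-- The exact identity in the additive group form:
`Σ_{γ ∈ R} φ(γ) − μ(𝓕)⁻¹ ∫_A φ dμ = μ(𝓕)⁻¹ Σ_{γ ∈ R} ∫_𝓕 (φ(γ) − φ(γ + u)) dμ(u)`.
[cite: Weil1965, Chap. I n° 12, proof of Lemme 5 (pp. 21–22)] -/
theorem sum_sub_smul_integral_eq_of_addSubgroup {𝓕 : Set A} {φ : A → V}
    (h𝓕 : IsAddFundamentalDomain Λ 𝓕 μ) (hφ : Integrable φ μ) (h0 : μ 𝓕 ≠ 0) (htop : μ 𝓕 ≠ ∞)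
    (R : Finset Λ) (hR : ∀ γ ∉ R, ∀ u ∈ 𝓕, φ ((γ : A) + u) = 0) :
    ∑ γ ∈ R, φ γ - (μ 𝓕).toReal⁻¹ • ∫ x, φ x ∂μ =
      (μ 𝓕).toReal⁻¹ • ∑ γ ∈ R, ∫ u in 𝓕, (φ γ - φ ((γ : A) + u)) ∂μ := by
  haveI := measurableConstVAdd_addSubgroup Λ
  haveI : VAddInvariantMeasure Λ A μ := vaddInvariantMeasure_addSubgroup Λ μ
  exact sum_sub_smul_integral_eq_of_vadd h𝓕 hφ h0 htop R hR (fun γ => φ γ)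

end AddSubgroup

/-! ## §7 (F4) Compact support: finiteness of the charged cells and the bound uniform in the shift -/

section Compact

variable {A : Type*} [AddCommGroup A] [TopologicalSpace A] [IsTopologicalAddGroup A]
  [MeasurableSpace A] [BorelSpace A] {μ : Measure A} [μ.IsAddLeftInvariant]
  [IsFiniteMeasureOnCompacts μ] (Λ : AddSubgroup A) [Countable Λ]
  {V : Type*} [NormedAddCommGroup V] [NormedSpace ℝ V] [CompleteSpace V]

omit [TopologicalSpace A] [IsTopologicalAddGroup A] [MeasurableSpace A] [BorelSpace A]
  [IsFiniteMeasureOnCompacts μ] [Countable Λ] [NormedSpace ℝ V] [CompleteSpace V] in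
/-- **FINITENESS OF THE CHARGED CELLS, uniformly described.** If `Λ` meets every compact set in
finitely many points, `G` vanishes off `C` and `K ⊇ (C − W) − s` is compact, then the lattice
points `λ` with `G(λ + s + w) ≠ 0` for some `w ∈ W` all lie in the finite set `Λ ∩ K`.
[cite: Weil1965, Chap. I n° 12, proof of Lemme 5 (pp. 21–22)] -/
theorem coe_mem_of_apply_add_add_ne_zero {C W : Set A} {G : A → V} (hGC : ∀ a ∉ C, G a = 0)
    (s : A) {l : Λ} {w : A} (hw : w ∈ W) (h : G ((l : A) + s + w) ≠ 0) :
    (l : A) ∈ (fun a : A => a - s) '' (C - W) := by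
  have hmem : (l : A) + s + w ∈ C := by
    by_contra hc
    exact h (hGC _ hc)
  refine ⟨(l : A) + s, ⟨(l : A) + s + w, hmem, w, hw, by abel⟩, by abel⟩

/-- **(F4) LATTICE SUM VS NORMALISED INTEGRAL, compact support, uniform in the shift.** Let `A` be
a commutative topological group with a Borel measure `μ` that is translation invariant and finite on
compact sets, `Λ ≤ A` a countable subgroup meeting every compact set in finitely many points
(`hΛ`), `P` a fundamental domain of `Λ` of non-zero measure with compact closure, and `G : A → V`
integrable, vanishing off a compact set `C`, with oscillation `‖G(a) − G(a + v)‖ ≤ ω` over `v ∈ P`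
(`ω ≥ 0`). Then for EVERY shift `s`: the set `{λ ∈ Λ | G(λ + s) ≠ 0}` is finite, and
`‖Σ_{λ ∈ Λ} G(λ + s) − μ(P)⁻¹ ∫ G dμ‖ ≤ ω · μ((C − ({0} ∪ P̄)) + P̄) / μ(P)` — the right-hand side
does not depend on `s` (Rogawski (1990), p. 95: the difference of the unipotent lattice sum and
its integral is «absolutely integrable for every `T`»; here, one cell at a time).
[cite: Weil1965, Chap. I n° 12, proof of Lemme 5 (pp. 21–22)] -/
theorem norm_tsum_add_sub_smul_integral_le_of_isCompact
    (hΛ : ∀ K : Set A, IsCompact K → {l : Λ | (l : A) ∈ K}.Finite)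
    {P : Set A} (hP : IsAddFundamentalDomain Λ P μ) (h0 : μ P ≠ 0) (hPc : IsCompact (closure P))
    {C : Set A} (hC : IsCompact C) {G : A → V} (hG : Integrable G μ) (hGC : ∀ a ∉ C, G a = 0)
    {ω : ℝ} (hω0 : 0 ≤ ω) (hω : ∀ a, ∀ v ∈ P, ‖G a - G (a + v)‖ ≤ ω) (s : A) :
    {l : Λ | G ((l : A) + s) ≠ 0}.Finite ∧
      ‖∑' l : Λ, G ((l : A) + s) - (μ P).toReal⁻¹ • ∫ a, G a ∂μ‖ ≤
        ω * ((μ ((C - insert (0 : A) (closure P)) + closure P)).toReal / (μ P).toReal) := by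
  haveI := measurableConstVAdd_addSubgroup Λ
  haveI : VAddInvariantMeasure Λ A μ := vaddInvariantMeasure_addSubgroup Λ μ
  -- the compact set of charged lattice points and the finite set `R`
  set W : Set A := insert (0 : A) (closure P) with hW
  have hWc : IsCompact W := hPc.insert 0
  set K : Set A := (fun a : A => a - s) '' (C - W) with hK
  have hCW : IsCompact (C - W) := by
    rw [sub_eq_add_neg]
    exact hC.add hWc.neg
  have hKc : IsCompact K := hCW.image (continuous_id.sub continuous_const)
  set R : Finset Λ := (hΛ K hKc).toFinset with hR
  have hmemR : ∀ {l : Λ} {w : A}, w ∈ W → G ((l : A) + s + w) ≠ 0 → l ∈ R := by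
    intro l w hw h
    rw [hR, Set.Finite.mem_toFinset]
    exact coe_mem_of_apply_add_add_ne_zero Λ hGC s hw h
  -- the shifted function
  set φ : A → V := fun a => G (a + s) with hφ
  have hφi : Integrable φ μ := hG.comp_add_right s
  have hφint : ∫ a, φ a ∂μ = ∫ a, G a ∂μ := integral_add_right_eq_self G s
  have hPtop : μ P ≠ ∞ := ((measure_mono subset_closure).trans_lt hPc.measure_lt_top).ne
  -- cells off `R` carry nothing; sample values vanish off `R`
  have hcell : ∀ γ ∉ R, ∀ u ∈ P, φ (γ +ᵥ u) = 0 := by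
    intro γ hγ u hu
    by_contra h
    refine hγ (hmemR (Set.mem_insert_of_mem _ (subset_closure hu)) ?_)
    rw [hφ] at h
    change G ((γ : A) + u + s) ≠ 0 at h
    rwa [add_right_comm] at h
  have ha : ∀ γ ∉ R, G ((γ : A) + s) ≠ 0 → False := by
    intro γ hγ h
    refine hγ (hmemR (Set.mem_insert _ _) ?_)
    rwa [add_zero]
  have hfin : {l : Λ | G ((l : A) + s) ≠ 0}.Finite :=
    (R.finite_toSet).subset fun l hl => by
      by_contra hlR
      exact ha l hlR hl
  refine ⟨hfin, ?_⟩
  -- oscillation on the charged cells and the box `B`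
  have hosc : ∀ γ ∈ R, ∀ u ∈ P, ‖G ((γ : A) + s) - φ (γ +ᵥ u)‖ ≤ ω := by
    intro γ _ u hu
    change ‖G ((γ : A) + s) - G ((γ : A) + u + s)‖ ≤ ω
    rw [add_right_comm]
    exact hω _ u hu
  set B : Set A := (fun a : A => a - s) '' ((C - W) + closure P) with hB
  have hBc : IsCompact B := (hCW.add hPc).image (continuous_id.sub continuous_const)
  have hBtop : μ B ≠ ∞ := hBc.measure_lt_top.ne
  have hBsub : ∀ γ ∈ R, γ +ᵥ P ⊆ B := by
    intro γ hγ x hx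
    obtain ⟨u, hu, rfl⟩ := Set.mem_vadd_set.1 hx
    rw [hR, Set.Finite.mem_toFinset] at hγ
    obtain ⟨c, hc, hcs⟩ := hγ
    have hγ' : (γ : A) = c - s := hcs.symm
    refine ⟨c + u, Set.add_mem_add hc (subset_closure hu), ?_⟩
    show c + u - s = (γ : A) + u
    rw [hγ']
    abel
  have hB' : B = (fun a : A => a + s) ⁻¹' ((C - W) + closure P) := by
    ext a
    constructor
    · rintro ⟨t, ht, rfl⟩
      change t - s + s ∈ (C - W) + closure P
      rwa [sub_add_cancel]
    · intro ha
      exact ⟨a + s, ha, add_sub_cancel_right a s⟩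
  have hμB : μ B = μ ((C - W) + closure P) := by
    rw [hB']
    exact measure_preimage_add_right μ s _
  have ha' : ∀ γ ∉ R, G ((γ : A) + s) = 0 := fun γ hγ => by
    by_contra h
    exact ha γ hγ h
  calc ‖∑' l : Λ, G ((l : A) + s) - (μ P).toReal⁻¹ • ∫ a, G a ∂μ‖
      = ‖∑' l : Λ, G ((l : A) + s) - (μ P).toReal⁻¹ • ∫ a, φ a ∂μ‖ := by rw [hφint]
    _ ≤ ω * ((μ B).toReal / (μ P).toReal) :=
        norm_tsum_sub_smul_integral_le_of_vadd_subset hP hφi h0 hPtop R hcell ha' hω0 hosc hBsub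
          hBtop
    _ = ω * ((μ ((C - W) + closure P)).toReal / (μ P).toReal) := by rw [hμB]

end Compact

end Literature.MeasureTheory.Group
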